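import Literature.AlgebraicGeometry.Motives.HodgeStructureCentreAdjointTotallyReal
import Literature.AlgebraicGeometry.Motives.HodgeLieRigidModuloCentre
import HarnessLib

/-!
# The centre of the Hodge Lie algebra is trivial when the polarization involution fixes the centre of
# `End_{HS}` — in weight one: when the centre of `End_{HS}` is totally real («no factors of Type 4 ⟹
# `Hg` is semi-simple», Moonen–Zarhin 1999 §1; Deligne LNM 900 I Prop. 3.6)

Family `hodge`, layer `Literature/AlgebraicGeometry/Motives` (pure Hodge structures); THEOREMS ONLY — no definition, no
named fact, no `sorry` (D-0026, net debt 0). Lane `lit-hodgefound` (Track 2 foundations library), prover seat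
`lit-hodgefound-p21`, generation 29, row g29-#8; the Hodge-structure half of the fold «no factor of type IV ⟹ `𝔷(𝔥) = 0`»,
feeding the hypothesis `h𝔷 : H.hodgeLie ⊓ Subalgebra.toSubmodule H.endAlg = ⊥` of the tree's `Motives/HodgeLieRigidModuloCentre`
(`rigid_of_center_eq_bot`: «e.g. `H¹` of an abelian variety without factors of type IV»), `HodgeLieRestrictDerivedSurjective`
(`hodgeLie_eq_map_restrict_of_center_eq_bot`), `HodgeLieRigidDirectSum`; it generalises the tree's
`hodgeLie_inf_endAlg_eq_bot_of_forall_endAlg_eq_smul` (`End_{HS} = ℚ`).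

THE ARGUMENT (Deligne I 3.6 / Moonen–Zarhin §1, held `paper:arxiv-math_9901113` p0002: «The Hodge group `Hg(X)` is a torus
if and only if `X` is of CM-type. If `X` has no factors of Type 4 then `Hg(X)` is semi-simple»). Let `z ∈ 𝔥 = Lie Hg(H)`
be central. Elements of `𝔥` commute with `End_{HS}(H)` (tree `commute_of_mem_hodgeLie`) and a rational endomorphism
commuting with `𝔥` is a Hodge endomorphism (tree `mem_endAlg_of_forall_commute`); so the centre of `𝔥` is
`𝔥 ∩ End_{HS}(H)`, inside the centre of `End_{HS}(H)`. Every `z ∈ 𝔥` is `ψ`-skew for a polarization `ψ`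
(tree `form_apply_add_eq_zero_of_mem_hodgeLie`): `z† = -z`. If `†` fixes the centre of `End_{HS}(H)` pointwise then
`z† = z`, so `z = 0` (`ψ` non-degenerate). In weight one `†` fixes the centre pointwise iff the centre is totally real
(g28-#9 `Polarization.forall_center_adjoint_eq_iff_center_totallyReal`; here through the tree's
`forall_central_skew_eq_zero_of_center_totallyReal`), which for `H = H¹(A)` is «`A` has no factor of type IV» (g29-#6
`AbelianVariety.hasNoTypeIVFactor_iff_center_endAlg_hodge_one_totallyReal`; the abelian-variety statement is row g29-#9).

MAIN RESULTS (all proved; `hZ` = «the centre of `End_{HS}(H)` is totally real» in the polynomial form of g28-#9 / g29-#4):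
* §1 (any weight) `Polarization.adjoint_eq_neg_of_mem_hodgeLie` (`𝔥 ⊆ 𝔰𝔭/𝔰𝔬(V, ψ)`: `z† = -z`),
  **`Polarization.eq_zero_of_mem_hodgeLie_of_adjoint_eq`** (`z ∈ 𝔥`, `z† = z ⟹ z = 0`),
  `forall_commute_endAlg_of_mem_hodgeLie` / `mem_endAlg_iff_forall_commute_hodgeLie` (`End_{HS}` is the commutant of
  `𝔥`; the centre of `𝔥` is `𝔥 ∩ End_{HS}`), **`Polarization.hodgeLie_inf_endAlg_eq_bot_of_forall_center_adjoint_eq`** (`†` fixes the centre ⟹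
  `𝔷 = 0`), `Polarization.eq_zero_of_mem_hodgeLie_of_forall_commute_of_forall_center_adjoint_eq` (literally: a central
  element of `𝔥` is `0`).
* §2 (weight one, effective) **`hodgeLie_inf_endAlg_eq_bot_of_center_totallyReal`** (and `_of_isPolarizable`),
  `eq_zero_of_mem_hodgeLie_of_forall_commute_of_center_totallyReal`,
  `hodgeLie_inf_endAlg_eq_bot_of_commutative_of_totallyReal` (commutative totally real `End_{HS}`: real multiplication).
* §3 `Θ`-rigidity (tree `rigid_of_center_eq_bot`): **`rigid_of_center_totallyReal`**, `rigid_of_forall_center_adjoint_eq`.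

## References

* [MoonenZarhin1999LowDim] B. Moonen, Yu. Zarhin, *Hodge classes on abelian varieties of low dimension*, Math. Ann. 315
  (1999), §1 («no factors of Type 4 ⟹ `Hg(X)` semi-simple»). [cite: MoonenZarhin1999LowDim, §1]
* [Deligne1982HodgeCycles] P. Deligne, *Hodge cycles on abelian varieties*, LNM 900 (1982), I §3 Prop. 3.6 (the centre of
  `MT` and the involution of a polarization). [cite: Deligne1982HodgeCycles, I §3 Prop. 3.6]
* [Huybrechts2016K3] D. Huybrechts, *Lectures on K3 Surfaces*, §3.3.4–3.3.5, Thm. 3.3.9. [cite: Huybrechts2016K3, Thm. 3.3.9]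
* [Moonen2017FamiliesMotives] B. Moonen, *Families of motives and the Mumford–Tate conjecture*, §2.1. [cite: Moonen2017FamiliesMotives, §2.1 (p. 3)]
-/

noncomputable section

namespace Literature.AlgebraicGeometry.Motives

namespace HodgeStructure

universe u

variable {V : Type u} [AddCommGroup V] [Module ℚ V] [Module.Finite ℚ V] [HodgeTensorFacts.{u, u}] {n : ℤ}
  {H : HodgeStructure V n}

/-! ### §1 Any weight: `𝔥 ⊆ 𝔰𝔭(V, ψ)`, the centre of `𝔥` lies in `End_{HS}`, and `†`-fixed elements of `𝔥` vanish -/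

/-- **`z† = -z` for `z ∈ 𝔥 = Lie Hg(H)`** (`𝔥 ⊆ 𝔰𝔬/𝔰𝔭(V, ψ)`, infinitesimal form of `Hg ⊆ Aut(V, ψ)`; tree
`form_apply_add_eq_zero_of_mem_hodgeLie`, uniqueness of adjoints). [cite: Huybrechts2016K3, Thm. 3.3.9 (proof, p. 67)]
[cite: Deligne1982HodgeCycles, I §3 Prop. 3.6] -/
theorem Polarization.adjoint_eq_neg_of_mem_hodgeLie (ψ : H.Polarization) {z : Module.End ℚ V} (hz : z ∈ H.hodgeLie) :
    ψ.adjoint z = -z := by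
  refine (ψ.eq_adjoint_of_isAdjointPair fun v w => ?_).symm
  rw [LinearMap.neg_apply, map_neg]
  linear_combination form_apply_add_eq_zero_of_mem_hodgeLie ψ hz v w

/-- **A `†`-fixed element of `𝔥` is zero**: `z ∈ 𝔥` is `ψ`-skew, so `z† = z` gives `2ψ(zv, w) = 0` for all `v, w`, and
`ψ` is non-degenerate. [cite: Deligne1982HodgeCycles, I §3 Prop. 3.6] [cite: MoonenZarhin1999LowDim, §1] -/
theorem Polarization.eq_zero_of_mem_hodgeLie_of_adjoint_eq (ψ : H.Polarization) {z : Module.End ℚ V}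
    (hz : z ∈ H.hodgeLie) (hadj : ψ.adjoint z = z) : z = 0 := by
  refine LinearMap.ext fun v => ?_
  rw [LinearMap.zero_apply]
  refine ψ.nondegenerate.1 (z v) fun w => ?_
  have h1 := form_apply_add_eq_zero_of_mem_hodgeLie ψ hz v w
  have h2 : ψ.form v (z w) = ψ.form (z v) w := by rw [← ψ.form_apply_adjoint z v w, hadj]
  linear_combination (h1 - h2) / 2

/-- **`𝔥` commutes with `End_{HS}(H)`** (tree `commute_of_mem_hodgeLie`, membership form): an element of `𝔥` which is a
Hodge endomorphism is central in `End_{HS}(H)`. [cite: Huybrechts2016K3, Thm. 3.3.9 (proof, p. 67)] -/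
theorem forall_commute_endAlg_of_mem_hodgeLie {z : Module.End ℚ V} (hz : z ∈ H.hodgeLie) :
    ∀ b ∈ H.endAlg, z * b = b * z :=
  fun b hb => commute_of_mem_hodgeLie H hz ⟨b, hb⟩

/-- **`End_{HS}(H)` is the commutant of `𝔥`** (so the centre of `𝔥` is `𝔥 ∩ End_{HS}(H)`): a rational endomorphism is
a Hodge endomorphism iff it commutes with `𝔥` (`⟹`: `𝔥` commutes with `End_{HS}`, tree `commute_of_mem_hodgeLie`; `⟸`:
tree `mem_endAlg_of_forall_commute`, `End_{Hg}(V) = End_{HS}(V)`).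
[cite: Huybrechts2016K3, §3.3.4 (p. 66) and Thm. 3.3.9] [cite: Deligne1982HodgeCycles, I §3 Prop. 3.6] -/
theorem mem_endAlg_iff_forall_commute_hodgeLie {z : Module.End ℚ V} :
    z ∈ H.endAlg ↔ ∀ X ∈ H.hodgeLie, z * X = X * z :=
  ⟨fun hzE _ hX => (commute_of_mem_hodgeLie H hX ⟨z, hzE⟩).symm, mem_endAlg_of_forall_commute H⟩

omit [Module.Finite ℚ V] [HodgeTensorFacts.{u, u}] in
/-- Unfolding of `z ∈ 𝔥 ⊓ End_{HS}`. [folklore] -/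
private theorem mem_inf_toSubmodule_iff [Module.Finite ℚ V] [HodgeTensorFacts.{u, u}] {z : Module.End ℚ V} :
    z ∈ H.hodgeLie ⊓ Subalgebra.toSubmodule H.endAlg ↔ z ∈ H.hodgeLie ∧ z ∈ H.endAlg :=
  Submodule.mem_inf

/-- **IF `†` FIXES THE CENTRE OF `End_{HS}(H)` POINTWISE THEN `𝔷(𝔥) = 𝔥 ∩ End_{HS}(H) = 0`** (any weight, any
polarization `ψ`; the elements of `𝔥 ∩ End_{HS}` are central in `End_{HS}`, `†`-fixed by hypothesis and `ψ`-skew).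
[cite: Deligne1982HodgeCycles, I §3 Prop. 3.6] [cite: MoonenZarhin1999LowDim, §1] [cite: Moonen2017FamiliesMotives, §2.1 (p. 3)] -/
theorem Polarization.hodgeLie_inf_endAlg_eq_bot_of_forall_center_adjoint_eq (ψ : H.Polarization)
    (hfix : ∀ a ∈ H.endAlg, (∀ b ∈ H.endAlg, a * b = b * a) → ψ.adjoint a = a) :
    H.hodgeLie ⊓ Subalgebra.toSubmodule H.endAlg = ⊥ := by
  rw [eq_bot_iff]
  intro z hz
  obtain ⟨hz𝔥, hzE⟩ := mem_inf_toSubmodule_iff.1 hz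
  rw [Submodule.mem_bot]
  exact ψ.eq_zero_of_mem_hodgeLie_of_adjoint_eq hz𝔥 (hfix z hzE (forall_commute_endAlg_of_mem_hodgeLie hz𝔥))

/-- … literally: **every central element of the Lie algebra `𝔥 = Lie Hg(H)` is zero** (`Hg(H)` is semisimple).
[cite: Deligne1982HodgeCycles, I §3 Prop. 3.6] [cite: MoonenZarhin1999LowDim, §1] -/
theorem Polarization.eq_zero_of_mem_hodgeLie_of_forall_commute_of_forall_center_adjoint_eq (ψ : H.Polarization)
    (hfix : ∀ a ∈ H.endAlg, (∀ b ∈ H.endAlg, a * b = b * a) → ψ.adjoint a = a) {z : Module.End ℚ V}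
    (hz : z ∈ H.hodgeLie) (hc : ∀ X ∈ H.hodgeLie, z * X = X * z) : z = 0 :=
  ψ.eq_zero_of_mem_hodgeLie_of_adjoint_eq hz
    (hfix z (mem_endAlg_of_forall_commute H hc) (forall_commute_endAlg_of_mem_hodgeLie hz))

/-! ### §2 Weight one: totally real centre of `End_{HS}(H)` («no factors of Type 4») -/

/-- **WEIGHT ONE: IF THE CENTRE OF `End_{HS}(H)` IS TOTALLY REAL THEN `𝔷(𝔥) = 𝔥 ∩ End_{HS}(H) = 0`** — «If `X` has no
factors of Type 4 then `Hg(X)` is semi-simple». (A central `ψ`-skew Hodge endomorphism vanishes when the centre is totally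
real: tree `forall_central_skew_eq_zero_of_center_totallyReal`; the elements of `𝔥 ∩ End_{HS}` are such.)
[cite: MoonenZarhin1999LowDim, §1] [cite: Deligne1982HodgeCycles, I §3 Prop. 3.6] -/
theorem hodgeLie_inf_endAlg_eq_bot_of_center_totallyReal (hn : n = 1) (heff : H.IsEffective) (ψ : H.Polarization)
    (hZ : ∀ a ∈ H.endAlg, (∀ b ∈ H.endAlg, a * b = b * a) →
      ∃ f : Polynomial ℚ, f ≠ 0 ∧ Polynomial.aeval a f = 0 ∧ ∀ z : ℂ, Polynomial.aeval z f = 0 → z.im = 0) :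
    H.hodgeLie ⊓ Subalgebra.toSubmodule H.endAlg = ⊥ := by
  rw [eq_bot_iff]
  intro z hz
  obtain ⟨hz𝔥, hzE⟩ := mem_inf_toSubmodule_iff.1 hz
  rw [Submodule.mem_bot]
  exact forall_central_skew_eq_zero_of_center_totallyReal H hn heff ψ hZ z hzE
    (forall_commute_endAlg_of_mem_hodgeLie hz𝔥) (form_apply_add_eq_zero_of_mem_hodgeLie ψ hz𝔥)

/-- The same for a polarizable `H` (any polarization will do). [cite: MoonenZarhin1999LowDim, §1]
[cite: Deligne1982HodgeCycles, I §3 Prop. 3.6] -/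
theorem hodgeLie_inf_endAlg_eq_bot_of_center_totallyReal_of_isPolarizable (hn : n = 1) (heff : H.IsEffective)
    (hH : H.IsPolarizable)
    (hZ : ∀ a ∈ H.endAlg, (∀ b ∈ H.endAlg, a * b = b * a) →
      ∃ f : Polynomial ℚ, f ≠ 0 ∧ Polynomial.aeval a f = 0 ∧ ∀ z : ℂ, Polynomial.aeval z f = 0 → z.im = 0) :
    H.hodgeLie ⊓ Subalgebra.toSubmodule H.endAlg = ⊥ := by
  obtain ⟨ψ⟩ := hH
  exact hodgeLie_inf_endAlg_eq_bot_of_center_totallyReal hn heff ψ hZ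

/-- … literally: in weight one with totally real centre of `End_{HS}(H)`, **every central element of `𝔥` is zero**.
[cite: MoonenZarhin1999LowDim, §1] [cite: Deligne1982HodgeCycles, I §3 Prop. 3.6] -/
theorem eq_zero_of_mem_hodgeLie_of_forall_commute_of_center_totallyReal (hn : n = 1) (heff : H.IsEffective)
    (ψ : H.Polarization)
    (hZ : ∀ a ∈ H.endAlg, (∀ b ∈ H.endAlg, a * b = b * a) →
      ∃ f : Polynomial ℚ, f ≠ 0 ∧ Polynomial.aeval a f = 0 ∧ ∀ z : ℂ, Polynomial.aeval z f = 0 → z.im = 0)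
    {z : Module.End ℚ V} (hz : z ∈ H.hodgeLie) (hc : ∀ X ∈ H.hodgeLie, z * X = X * z) : z = 0 :=
  forall_central_skew_eq_zero_of_center_totallyReal H hn heff ψ hZ z
    (mem_endAlg_of_forall_commute H hc) (forall_commute_endAlg_of_mem_hodgeLie hz)
    (form_apply_add_eq_zero_of_mem_hodgeLie ψ hz)

/-- **Commutative totally real `End_{HS}(H)` (real multiplication) ⟹ `𝔷(𝔥) = 0`** (weight one): the centre is all of
`End_{HS}(H)`. [cite: MoonenZarhin1999LowDim, §1] [cite: Deligne1982HodgeCycles, I §3 Prop. 3.6] -/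
theorem hodgeLie_inf_endAlg_eq_bot_of_commutative_of_totallyReal (hn : n = 1) (heff : H.IsEffective)
    (ψ : H.Polarization) (hR : ∀ a ∈ H.endAlg,
      ∃ f : Polynomial ℚ, f ≠ 0 ∧ Polynomial.aeval a f = 0 ∧ ∀ z : ℂ, Polynomial.aeval z f = 0 → z.im = 0) :
    H.hodgeLie ⊓ Subalgebra.toSubmodule H.endAlg = ⊥ :=
  hodgeLie_inf_endAlg_eq_bot_of_center_totallyReal hn heff ψ fun a ha _ => hR a ha

/-! ### §3 `Θ`-rigidity (tree `rigid_of_center_eq_bot`) -/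

/-- **Weight one, totally real centre ⟹ `H` is `Θ`-rigid**: every bracket-closed rational `𝔞 ⊆ 𝔥(H)` whose complex span
contains a Hodge operator `Θ` is all of `𝔥(H)` (tree `rigid_of_center_eq_bot` at §2).
[cite: MoonenZarhin1999LowDim, §1 and §3 (3.1)] [cite: Deligne1982HodgeCycles, I §3 Prop. 3.6] -/
theorem rigid_of_center_totallyReal (hn : n = 1) (heff : H.IsEffective) (hH : H.IsPolarizable)
    (hZ : ∀ a ∈ H.endAlg, (∀ b ∈ H.endAlg, a * b = b * a) →
      ∃ f : Polynomial ℚ, f ≠ 0 ∧ Polynomial.aeval a f = 0 ∧ ∀ z : ℂ, Polynomial.aeval z f = 0 → z.im = 0) :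
    ∀ 𝔞 : Submodule ℚ (Module.End ℚ V), 𝔞 ≤ H.hodgeLie →
      (∀ X ∈ 𝔞, ∀ Y ∈ 𝔞, X * Y - Y * X ∈ 𝔞) →
      (∃ Θ ∈ Submodule.span ℂ ((fun X : Module.End ℚ V => X.baseChange ℂ) '' (𝔞 : Set (Module.End ℚ V))),
        ∀ p, ∀ x ∈ H.piece p (n - p), Θ x = ((2 * p - n : ℤ) : ℂ) • x) → H.hodgeLie ≤ 𝔞 :=
  rigid_of_center_eq_bot H hH (hodgeLie_inf_endAlg_eq_bot_of_center_totallyReal_of_isPolarizable hn heff hH hZ)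

/-- **`†` fixes the centre of `End_{HS}(H)` ⟹ `H` is `Θ`-rigid** (any weight).
[cite: MoonenZarhin1999LowDim, §3 (3.1)] [cite: Deligne1982HodgeCycles, I §3 Prop. 3.6] -/
theorem Polarization.rigid_of_forall_center_adjoint_eq (ψ : H.Polarization)
    (hfix : ∀ a ∈ H.endAlg, (∀ b ∈ H.endAlg, a * b = b * a) → ψ.adjoint a = a) :
    ∀ 𝔞 : Submodule ℚ (Module.End ℚ V), 𝔞 ≤ H.hodgeLie →
      (∀ X ∈ 𝔞, ∀ Y ∈ 𝔞, X * Y - Y * X ∈ 𝔞) →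
      (∃ Θ ∈ Submodule.span ℂ ((fun X : Module.End ℚ V => X.baseChange ℂ) '' (𝔞 : Set (Module.End ℚ V))),
        ∀ p, ∀ x ∈ H.piece p (n - p), Θ x = ((2 * p - n : ℤ) : ℂ) • x) → H.hodgeLie ≤ 𝔞 :=
  rigid_of_center_eq_bot H ⟨ψ⟩ (ψ.hodgeLie_inf_endAlg_eq_bot_of_forall_center_adjoint_eq hfix)

end HodgeStructure

end Literature.AlgebraicGeometry.Motives
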